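import Summits.CriticalPhenomena.PercolationContinuityZ3.Theorems.Transplant.FKConnectivityAllQAntipodalRootFormAttachS

/-!
# Connectivity correlation inequalities for `φ_{w,q}`, every `q > 0` — ROOT-FORM CALCULUS, file 61w′: GENERAL SERIES ATTACHMENT, fact 2
# (the general (SQ): `M̃_{g ∥ (B·𝓔)} ≥ 0`) and the bundle `attS_facts`

Support file (`--supports stmt-CriticalPhenomena-4575`), FK sub-lane `prim-bschramm-fk-2` (gen 29); builds on p205010 (kernel theorem,
internal audit signed; external expert review pending).  No definitions, no named facts, no sorries; standard axioms.  Memo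
FROM-fk-2-g28-ROOT-FORM.md §3 ((SQ) general).  By kind of the box configuration, `g ∥ (B·𝓔)` is: `(1,1)` → `g ∥ 𝓔` (fact 2 of `𝓔`),
`(1,0)/(0,1)` → the two sections of `g ∥ (f·𝓔)` (regrouped by level against aggregate weights; `FK.RootForm.Mt_par_ser_nonneg`, the signed term
vanishes), `(0,0)` → a parallel edge over a doubly cut environment (`slots_par_cut`: deleted ANDs ± the exact deleted levels, paired with the
nested weights).  `attS_facts`: the five facts pass from `𝓔` to `B·𝓔`.
[folklore]
-/

noncomputable section

namespace Summit.CriticalPhenomena.PercolationContinuityZ3.Theorems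

namespace FK

namespace RootForm

open Finset Base

section ParE

variable {BB C : Type*} [Fintype BB] [Preorder BB] [Fintype C] [Preorder C] (B : BB → SDat) (E : Env C)

omit [Fintype BB] [Preorder BB] [Fintype C] [Preorder C] in
set_option linter.unusedSimpArgs false in
/-- The four sub-slots of a parallel edge over a doubly cut environment (kind `(0,0)` of `g ∥ (B·𝓔)`): deleted ANDs plus/minus the exact
deleted levels of the one-special patterns. [folklore] -/
theorem slots_par_cut (e : EDat) (J : ℤ) :
    ((((e.ser false).ser true).par true).slot1 J = e.andDel (J - 1) + (ind (e.dy.lam = J) + ind (e.dz.lam = J))) ∧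
    ((((e.ser false).ser true).par true).slot0 J = e.andDel J) ∧
    ((((e.ser false).ser true).par false).slot1 J = e.andDel J) ∧
    ((((e.ser false).ser true).par false).slot0 J = e.andDel (J - 1) - (ind (e.dy.lam = J) + ind (e.dz.lam = J))) := by
  obtain ⟨⟨l0, a0, b0⟩, ⟨ly, ay, b1⟩, ⟨lz, az, bz⟩, ⟨lw, aw, bw⟩⟩ := e
  simp only [EDat.ser, EDat.par, PDat.ser, PDat.par, EDat.slot1, EDat.slot0, EDat.andDel, PDat.a1, PDat.a2, PDat.r1, PDat.r2, PDat.adel,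
    Bool.false_and, Bool.true_and, Bool.not_false, Bool.not_true, Bool.and_false, Bool.and_true, Bool.or_false, Bool.or_true,
    Bool.false_or, Bool.true_or, bit_true, bit_false, add_zero, and_true, and_false, Bool.false_eq_true, ind_False, sub_zero]
  refine ⟨?_, trivial, trivial, ?_⟩
  · rw [ind_congr (show l0 + 1 ≤ J ↔ l0 ≤ J - 1 by omega), ind_congr (show lw + 1 ≤ J ↔ lw ≤ J - 1 by omega)]; ring
  · rw [ind_congr (show l0 + 1 ≤ J ↔ l0 ≤ J - 1 by omega), ind_congr (show lw + 1 ≤ J ↔ lw ≤ J - 1 by omega)]; ring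

omit [Fintype BB] [Preorder BB] [Fintype C] [Preorder C] in
set_option linter.unusedSimpArgs false in
/-- **Pointwise decomposition of the integrand of `g ∥ (B · 𝓔)` by kind.** [folklore] -/
theorem parE_attS_integrand_kind (H0 H1 : Bool × (BB × C) → ℝ) (J : ℤ) (β : BB) (b : Bool) (γ : C) :
    H1 (b, (β, γ)) * (parE (attS B E) (b, (β, γ))).slot1 J + H0 (b, (β, γ)) * (parE (attS B E) (b, (β, γ))).slot0 J =
      kd (B β) true true * (H1 (b, (β, γ)) * (parE E (b, γ)).slot1 (J - (B β).L) + H0 (b, (β, γ)) * (parE E (b, γ)).slot0 (J - (B β).L))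
      + kd (B β) true false * (H1 (b, (β, γ)) * (parE (serE E) (b, (true, γ))).slot1 (J - (B β).L)
          + H0 (b, (β, γ)) * (parE (serE E) (b, (true, γ))).slot0 (J - (B β).L))
      + kd (B β) false true * (H1 (b, (β, γ)) * (parE (serE E) (b, (false, γ))).slot1 (J - (B β).L)
          + H0 (b, (β, γ)) * (parE (serE E) (b, (false, γ))).slot0 (J - (B β).L))
      + kd (B β) false false * (H1 (b, (β, γ)) * ((((E γ).ser false).ser true).par b).slot1 (J - (B β).L)
          + H0 (b, (β, γ)) * ((((E γ).ser false).ser true).par b).slot0 (J - (B β).L)) := by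
  have hk := fun d : PDat => scomb_par_of_kind (B β) d b
  cases hc : (B β).c <;> cases hcb : (B β).cb
  · have h := integrands_of_addLam ((((E γ).ser false).ser true).par b) (parE (attS B E) (b, (β, γ))) (B β).L
      (((hk _).2.2.2) hc hcb) (((hk _).2.2.2) hc hcb) (((hk _).2.2.2) hc hcb) (((hk _).2.2.2) hc hcb) J
    rw [h.1, h.2.1]
    simp only [kd, hc, hcb, Bool.true_eq_false, Bool.false_eq_true, and_self, and_true, and_false, true_and, false_and, if_true,
      if_false]; ring
  · have h := integrands_of_addLam (parE (serE E) (b, (false, γ))) (parE (attS B E) (b, (β, γ))) (B β).L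
      (((hk _).2.2.1) hc hcb) (((hk _).2.2.1) hc hcb) (((hk _).2.2.1) hc hcb) (((hk _).2.2.1) hc hcb) J
    rw [h.1, h.2.1]
    simp only [kd, hc, hcb, Bool.true_eq_false, Bool.false_eq_true, and_self, and_true, and_false, true_and, false_and, if_true,
      if_false]; ring
  · have h := integrands_of_addLam (parE (serE E) (b, (true, γ))) (parE (attS B E) (b, (β, γ))) (B β).L
      (((hk _).2.1) hc hcb) (((hk _).2.1) hc hcb) (((hk _).2.1) hc hcb) (((hk _).2.1) hc hcb) J
    rw [h.1, h.2.1]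
    simp only [kd, hc, hcb, Bool.true_eq_false, Bool.false_eq_true, and_self, and_true, and_false, true_and, false_and, if_true,
      if_false]; ring
  · have h := integrands_of_addLam (parE E (b, γ)) (parE (attS B E) (b, (β, γ))) (B β).L
      (((hk _).1) hc hcb) (((hk _).1) hc hcb) (((hk _).1) hc hcb) (((hk _).1) hc hcb) J
    rw [h.1, h.2.1]
    simp only [kd, hc, hcb, Bool.true_eq_false, Bool.false_eq_true, and_self, and_true, and_false, true_and, false_and, if_true,
      if_false]; ring

omit [Fintype BB] [Fintype C] in
/-- sections of a monotone weight on `Bool × (BB × C)` at a box configuration. [folklore] -/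
theorem mono_at {H : Bool × (BB × C) → ℝ} (hH : Monotone H) (β : BB) : Monotone fun q : Bool × C => H (q.1, (β, q.2)) :=
  fun _ _ hpq => hH (Prod.mk_le_mk.2 ⟨(Prod.mk_le_mk.1 hpq).1, Prod.mk_le_mk.2 ⟨le_rfl, (Prod.mk_le_mk.1 hpq).2⟩⟩)

omit [Fintype BB] [Fintype C] in
/-- the weight with the parallel-edge coordinate moved inside is monotone. [folklore] -/
theorem mono_inside {H : Bool × (BB × C) → ℝ} (hH : Monotone H) : Monotone fun p : BB × (Bool × C) => H (p.2.1, (p.1, p.2.2)) :=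
  fun _ _ hpq => hH (Prod.mk_le_mk.2 ⟨(Prod.mk_le_mk.1 (Prod.mk_le_mk.1 hpq).2).1,
    Prod.mk_le_mk.2 ⟨(Prod.mk_le_mk.1 hpq).1, (Prod.mk_le_mk.1 (Prod.mk_le_mk.1 hpq).2).2⟩⟩)

omit [Fintype C] in
/-- the aggregate weight with the parallel-edge coordinate moved outside is monotone on `Bool × (Bool × C)`. [folklore] -/
theorem aggW_outside_mono (hU : ∀ h : BB → ℝ, Monotone h → (∀ β, 0 ≤ h β) → ∀ K : ℤ,
      0 ≤ ∑ β, h β * ((if (B β).L = K then (1 : ℝ) else 0) * (kd (B β) true false - kd (B β) false true)))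
    {H' : BB × (Bool × C) → ℝ} (mH : Monotone H') (nH : ∀ p, 0 ≤ H' p) (K : ℤ) :
    Monotone fun q : Bool × (Bool × C) => aggW B K H' (q.2.1, (q.1, q.2.2)) := by
  have hm := aggW_mono B (C := Bool × C) hU mH nH K
  exact fun _ _ hpq => hm (Prod.mk_le_mk.2 ⟨(Prod.mk_le_mk.1 (Prod.mk_le_mk.1 hpq).2).1,
    Prod.mk_le_mk.2 ⟨(Prod.mk_le_mk.1 hpq).1, (Prod.mk_le_mk.1 (Prod.mk_le_mk.1 hpq).2).2⟩⟩)

/-- **Fact 2 for `B · 𝓔`** (the general (SQ)): `M̃_{g ∥ (B·𝓔)} ≥ 0` from facts 1, 2, 3, 5 of `𝓔` and Theorem U for `B`. [folklore] -/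
theorem attS_parE_Mt_nonneg
    (hU : ∀ h : BB → ℝ, Monotone h → (∀ β, 0 ≤ h β) → ∀ K : ℤ,
      0 ≤ ∑ β, h β * ((if (B β).L = K then (1 : ℝ) else 0) * (kd (B β) true false - kd (B β) false true)))
    (f1 : ∀ h0 h1 : C → ℝ, Monotone h0 → Monotone h1 → (∀ γ, 0 ≤ h0 γ) → (∀ γ, h0 γ ≤ h1 γ) → ∀ J : ℤ, 0 ≤ Mt E h0 h1 J)
    (f2 : ∀ h0 h1 : Bool × C → ℝ, Monotone h0 → Monotone h1 → (∀ p, 0 ≤ h0 p) → (∀ p, h0 p ≤ h1 p) → ∀ J : ℤ, 0 ≤ Mt (parE E) h0 h1 J)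
    (f3 : ∀ h : C → ℝ, Monotone h → (∀ γ, 0 ≤ h γ) → ∀ J : ℤ, 0 ≤ ∑ γ, h γ * (E γ).andDel J)
    (f5 : ∀ h0 h1 : C → ℝ, Monotone h0 → Monotone h1 → (∀ γ, 0 ≤ h0 γ) → (∀ γ, h0 γ ≤ h1 γ) → ∀ J : ℤ,
      0 ≤ ∑ γ, (h1 γ * (E γ).andE1 J + h0 γ * (E γ).andE2 J))
    {H0 H1 : Bool × (BB × C) → ℝ} (m0 : Monotone H0) (m1 : Monotone H1) (n0 : ∀ p, 0 ≤ H0 p) (le : ∀ p, H0 p ≤ H1 p) (J : ℤ) :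
    0 ≤ Mt (parE (attS B E)) H0 H1 J := by
  have n1 : ∀ p, 0 ≤ H1 p := fun p => (n0 p).trans (le p)
  -- reorder the sum: box configuration outermost
  let ψ : BB × (Bool × C) ≃ Bool × (BB × C) :=
    { toFun := fun q => (q.2.1, (q.1, q.2.2)), invFun := fun q => (q.2.1, (q.1, q.2.2)), left_inv := fun _ => rfl, right_inv := fun _ => rfl }
  have R := regroup B (C := Bool × C) (fun p => H0 (p.2.1, (p.1, p.2.2))) (fun p => H1 (p.2.1, (p.1, p.2.2)))
    (fun q J => (parE (serE E) (q.1, (true, q.2))).slot1 J) (fun q J => (parE (serE E) (q.1, (true, q.2))).slot0 J)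
    (fun q J => (parE (serE E) (q.1, (false, q.2))).slot1 J) (fun q J => (parE (serE E) (q.1, (false, q.2))).slot0 J) J
  have RM : ∀ K, ∑ q : Bool × C, (aggW B K (fun p => H1 (p.2.1, (p.1, p.2.2))) (true, q) * (parE (serE E) (q.1, (true, q.2))).slot1 (J - K)
      + aggW B K (fun p => H0 (p.2.1, (p.1, p.2.2))) (true, q) * (parE (serE E) (q.1, (true, q.2))).slot0 (J - K)
      + (aggW B K (fun p => H1 (p.2.1, (p.1, p.2.2))) (false, q) * (parE (serE E) (q.1, (false, q.2))).slot1 (J - K)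
      + aggW B K (fun p => H0 (p.2.1, (p.1, p.2.2))) (false, q) * (parE (serE E) (q.1, (false, q.2))).slot0 (J - K))) =
      Mt (parE (serE E)) (fun q => aggW B K (fun p => H0 (p.2.1, (p.1, p.2.2))) (q.2.1, (q.1, q.2.2)))
        (fun q => aggW B K (fun p => H1 (p.2.1, (p.1, p.2.2))) (q.2.1, (q.1, q.2.2))) (J - K) := fun K => by
    unfold Mt
    rw [Fintype.sum_prod_type, Fintype.sum_prod_type]
    refine Finset.sum_congr rfl fun b _ => ?_
    rw [sum_bool_prod, ← Finset.sum_add_distrib]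
  -- kind (0,0): both replicas cut
  have h00 : ∀ β, 0 ≤ ∑ q : Bool × C, (H1 (q.1, (β, q.2)) * ((((E q.2).ser false).ser true).par q.1).slot1 (J - (B β).L)
      + H0 (q.1, (β, q.2)) * ((((E q.2).ser false).ser true).par q.1).slot0 (J - (B β).L)) := by
    intro β
    have e : ∑ q : Bool × C, (H1 (q.1, (β, q.2)) * ((((E q.2).ser false).ser true).par q.1).slot1 (J - (B β).L)
        + H0 (q.1, (β, q.2)) * ((((E q.2).ser false).ser true).par q.1).slot0 (J - (B β).L)) =
        ∑ γ, (H1 (true, (β, γ)) + H0 (false, (β, γ))) * (E γ).andDel (J - (B β).L - 1)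
        + ∑ γ, (H0 (true, (β, γ)) + H1 (false, (β, γ))) * (E γ).andDel (J - (B β).L)
        + ∑ γ, (H1 (true, (β, γ)) - H0 (false, (β, γ))) * (ind ((E γ).dy.lam = J - (B β).L) + ind ((E γ).dz.lam = J - (B β).L)) := by
      rw [sum_bool_prod, ← Finset.sum_add_distrib, ← Finset.sum_add_distrib, ← Finset.sum_add_distrib]
      refine Finset.sum_congr rfl fun γ _ => ?_
      obtain ⟨c1, c2, c3, c4⟩ := slots_par_cut (E γ) (J - (B β).L)
      simp only [c1, c2, c3, c4]; ring
    rw [e]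
    have a1 : Monotone fun γ => H1 (true, (β, γ)) := mono_sec (mono_at m1 β) true
    have a0 : Monotone fun γ => H0 (true, (β, γ)) := mono_sec (mono_at m0 β) true
    have b1 : Monotone fun γ => H1 (false, (β, γ)) := mono_sec (mono_at m1 β) false
    have b0 : Monotone fun γ => H0 (false, (β, γ)) := mono_sec (mono_at m0 β) false
    refine add_nonneg (add_nonneg (f3 _ (a1.add b0) (fun γ => add_nonneg (n1 _) (n0 _)) _)
      (f3 _ (a0.add b1) (fun γ => add_nonneg (n0 _) (n1 _)) _)) (Finset.sum_nonneg fun γ _ => mul_nonneg ?_ (add_nonneg (ind_nonneg _) (ind_nonneg _)))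
    exact sub_nonneg.2 ((sec_le (mono_at m0 β) γ).trans (le _))
  -- decompose
  have dec : ∀ (β : BB) (q : Bool × C), H1 (ψ (β, q)) * (parE (attS B E) (ψ (β, q))).slot1 J + H0 (ψ (β, q)) * (parE (attS B E) (ψ (β, q))).slot0 J =
      kd (B β) true true * (H1 (q.1, (β, q.2)) * (parE E q).slot1 (J - (B β).L) + H0 (q.1, (β, q.2)) * (parE E q).slot0 (J - (B β).L))
      + kd (B β) true false * (H1 (q.1, (β, q.2)) * (parE (serE E) (q.1, (true, q.2))).slot1 (J - (B β).L)
          + H0 (q.1, (β, q.2)) * (parE (serE E) (q.1, (true, q.2))).slot0 (J - (B β).L))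
      + kd (B β) false true * (H1 (q.1, (β, q.2)) * (parE (serE E) (q.1, (false, q.2))).slot1 (J - (B β).L)
          + H0 (q.1, (β, q.2)) * (parE (serE E) (q.1, (false, q.2))).slot0 (J - (B β).L))
      + kd (B β) false false * (H1 (q.1, (β, q.2)) * ((((E q.2).ser false).ser true).par q.1).slot1 (J - (B β).L)
          + H0 (q.1, (β, q.2)) * ((((E q.2).ser false).ser true).par q.1).slot0 (J - (B β).L)) := by
    intro β q; obtain ⟨b, γ⟩ := q; exact parE_attS_integrand_kind B E H0 H1 J β b γ
  unfold Mt
  rw [← Equiv.sum_comp ψ, Fintype.sum_prod_type]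
  rw [Finset.sum_congr rfl fun β _ => Finset.sum_congr rfl fun q _ => dec β q]
  simp only [Finset.sum_add_distrib]
  rw [show ∀ a b c d : ℝ, a + b + c + d = a + d + (b + c) from fun a b c d => by ring, R]
  refine add_nonneg (add_nonneg (Finset.sum_nonneg fun β _ => ?_) (Finset.sum_nonneg fun β _ => ?_)) (Finset.sum_nonneg fun K _ => ?_)
  · rw [← Finset.mul_sum]
    exact mul_nonneg (kd_nonneg _ _ _) (f2 _ _ (mono_at m0 β) (mono_at m1 β) (fun q => n0 _) (fun q => le _) _)
  · rw [← Finset.mul_sum]; exact mul_nonneg (kd_nonneg _ _ _) (h00 β)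
  · rw [RM]
    exact Mt_par_ser_nonneg f1 f3 f5 (aggW_outside_mono B hU (mono_inside m0) (fun p => n0 _) K)
      (aggW_outside_mono B hU (mono_inside m1) (fun p => n1 _) K) (fun q => aggW_nonneg B (fun p => n0 _) K _)
      (fun q => aggW_le B (fun p => le _) K _) _

/-- **The five facts pass from `𝓔` to `B · 𝓔`** for every abstract special-free box `B` with Theorem U at every exact level. [folklore] -/
theorem attS_facts
    (hU : ∀ h : BB → ℝ, Monotone h → (∀ β, 0 ≤ h β) → ∀ K : ℤ,
      0 ≤ ∑ β, h β * ((if (B β).L = K then (1 : ℝ) else 0) * (kd (B β) true false - kd (B β) false true)))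
    (h5 : (∀ h0 h1 : C → ℝ, Monotone h0 → Monotone h1 → (∀ γ, 0 ≤ h0 γ) → (∀ γ, h0 γ ≤ h1 γ) → ∀ J : ℤ, 0 ≤ Mt E h0 h1 J)
      ∧ (∀ h0 h1 : Bool × C → ℝ, Monotone h0 → Monotone h1 → (∀ p, 0 ≤ h0 p) → (∀ p, h0 p ≤ h1 p) → ∀ J : ℤ, 0 ≤ Mt (parE E) h0 h1 J)
      ∧ (∀ h : C → ℝ, Monotone h → (∀ γ, 0 ≤ h γ) → ∀ J : ℤ, 0 ≤ ∑ γ, h γ * (E γ).andDel J)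
      ∧ (∀ h : C → ℝ, Monotone h → (∀ γ, 0 ≤ h γ) → ∀ J : ℤ, 0 ≤ ∑ γ, h γ * (E γ).andCon J)
      ∧ (∀ h0 h1 : C → ℝ, Monotone h0 → Monotone h1 → (∀ γ, 0 ≤ h0 γ) → (∀ γ, h0 γ ≤ h1 γ) → ∀ J : ℤ,
          0 ≤ ∑ γ, (h1 γ * (E γ).andE1 J + h0 γ * (E γ).andE2 J))) :
    (∀ h0 h1 : BB × C → ℝ, Monotone h0 → Monotone h1 → (∀ γ, 0 ≤ h0 γ) → (∀ γ, h0 γ ≤ h1 γ) → ∀ J : ℤ, 0 ≤ Mt (attS B E) h0 h1 J)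
      ∧ (∀ h0 h1 : Bool × (BB × C) → ℝ, Monotone h0 → Monotone h1 → (∀ p, 0 ≤ h0 p) → (∀ p, h0 p ≤ h1 p) → ∀ J : ℤ,
        0 ≤ Mt (parE (attS B E)) h0 h1 J)
      ∧ (∀ h : BB × C → ℝ, Monotone h → (∀ γ, 0 ≤ h γ) → ∀ J : ℤ, 0 ≤ ∑ γ, h γ * (attS B E γ).andDel J)
      ∧ (∀ h : BB × C → ℝ, Monotone h → (∀ γ, 0 ≤ h γ) → ∀ J : ℤ, 0 ≤ ∑ γ, h γ * (attS B E γ).andCon J)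
      ∧ (∀ h0 h1 : BB × C → ℝ, Monotone h0 → Monotone h1 → (∀ γ, 0 ≤ h0 γ) → (∀ γ, h0 γ ≤ h1 γ) → ∀ J : ℤ,
          0 ≤ ∑ γ, (h1 γ * (attS B E γ).andE1 J + h0 γ * (attS B E γ).andE2 J)) := by
  obtain ⟨f1, f2, f3, f4, f5⟩ := h5
  exact ⟨fun _ _ m0 m1 n0 le J => attS_Mt_nonneg B E hU f1 f3 m0 m1 n0 le J,
    fun _ _ m0 m1 n0 le J => attS_parE_Mt_nonneg B E hU f1 f2 f3 f5 m0 m1 n0 le J,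
    fun h mh nh J => attS_andDel_nonneg B E f3 h mh nh J, fun h mh nh J => attS_andCon_nonneg B E hU f3 f4 f5 h mh nh J,
    fun h0 h1 m0 m1 n0 le J => attS_andFree_nonneg B E hU f3 f5 h0 h1 m0 m1 n0 le J⟩

end ParE

end RootForm

end FK

end Summit.CriticalPhenomena.PercolationContinuityZ3.Theorems

end
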